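import Mathlib
import HarnessLib
import Summits.NavierStokesRegularity.NavierStokesRegularity.Theorems.TaylorModelRungThreeDefs
import Summits.NavierStokesRegularity.NavierStokesRegularity.Theorems.TaylorModelRungThreeSoundnessODE
import Summits.NavierStokesRegularity.NavierStokesRegularity.Theorems.TaylorModelRungThreeSoundnessFlow

/-!
# Line `taylor-model` on crux K1b-DR (`ExactWindowRungThree.DerivativeEnclosureCertificateR`,
# stmt-NavierStokesRegularity-23954) — stub S1: `stub_soundness : TaylorModelSoundness`

The registered stub `stub_soundness : TaylorModelSoundness` of line `taylor-model` (skeleton v3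
`9391589be9c875b2`, line owner ns-idea-2 g3; statement `Theorems/TaylorModelRungThreeDefs.lean`,
p595822) — analytic soundness of Taylor models for quadratic fields on `Fin n → ℝ` by the METHOD OF
MAJORANTS — assembled from the helper files `TaylorModelRungThreeSoundness{Defs,Majorant,Series,ODE,Flow}.lean`:

* existence on `[0,t]` for `|x| ≤ m·w`, `b m t < 1`: the Taylor series solves the equation
  (`isSolOn_pseries`), so the global selector `flowSel Q` (value of any solution — they are unique) IS
  the series there (`flowSel_eq_pseries`, `hasDerivWithinAt_flowSel`);
* `HasFDerivAt` of the time-`s` map `y ↦ flowSel Q y s` with derivative `z ↦ Σ_k U y z k s^k`, from the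
  second-order majorant `g(M+η) - g(M) - η g'(M) = b s η²/((1-b(M+η)s)(1-bMs)²) = O(η²)`
  (`hasFDerivAt_pseries_T`, `flowSel_eventuallyEq_pseries`, `hasFDerivAt_flowSel`);
* `stub_soundness` — the literal statement `TaylorModelSoundness` with `Φ := flowSel Q`.

Reuse (critic P-TM2): Mathlib's `ODE_solution_unique_of_mem_Icc_right` (Grönwall),
`hasDerivAt_tsum_of_isPreconnected`, the real Cauchy product and geometric sums; the tree's
`highOrderEnclosure_step` is a ONE-STEP a priori test and cannot reach the majorant horizon `b m t < 1`,
so it is not on this stub's path (it serves the chain stub G). MODEL-lattice rung TL-M3 only — nothing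
here is a statement about the Navier–Stokes equations.
-/

noncomputable section

-- the sub-problem namespace repeats the summit name by design (D-0017)
set_option linter.dupNamespace false

namespace Summit.NavierStokesRegularity.NavierStokesRegularity.Theorems.TaylorModelMajorant

open scoped BigOperators Topology
open Finset Set Filter

variable {n : ℕ} {Q : (Fin n → ℝ) → (Fin n → ℝ) → Fin n → ℝ} {w : Fin n → ℝ} {b : ℝ}
  {T : (Fin n → ℝ) → ℕ → Fin n → ℝ} {U : (Fin n → ℝ) → (Fin n → ℝ) → ℕ → Fin n → ℝ}

namespace IsMajorantSystem

variable (h : IsMajorantSystem n Q w b T U)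
include h

/-! ### Existence on `[0,t]`: the selector is the Taylor series -/

/-- **Existence**: for `0 ≤ m`, `|x| ≤ m·w`, `0 ≤ t`, `b m t < 1` the Taylor series `σ ↦ Σ_k T x k σ^k`
solves `u' = Q(u,u)` on `[0,t]` from `x`. [folklore] -/
theorem isSolOn_pseries {x : Fin n → ℝ} {m t : ℝ} (hm : 0 ≤ m) (hx : ∀ c, |x c| ≤ m * w c)
    (ht : 0 ≤ t) (hq : b * m * t < 1) : IsSolOn Q x t (fun σ => pseries (T x) σ) := by
  obtain ⟨r, htr, hr, hqr⟩ := h.exists_radius hm ht hq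
  refine ⟨h.pseries_T_zero x, fun s hs => ?_⟩
  exact (h.hasDerivAt_pseries_T hx hr hqr ⟨hs.1, lt_of_le_of_lt hs.2 htr⟩).hasDerivWithinAt

/-- **The selector is the Taylor series** on `[0,t]` (`0 ≤ m`, `|x| ≤ m·w`, `b m t < 1`). [folklore] -/
theorem flowSel_eq_pseries {x : Fin n → ℝ} {m t : ℝ} (hm : 0 ≤ m) (hx : ∀ c, |x c| ≤ m * w c)
    (ht : 0 ≤ t) (hq : b * m * t < 1) {s : ℝ} (hs : s ∈ Set.Icc 0 t) :
    flowSel Q x s = pseries (T x) s :=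
  h.flowSel_eq (h.isSolOn_pseries hm hx ht hq) hs

/-- **The selector solves the equation on `[0,t]`** (`0 ≤ m`, `|x| ≤ m·w`, `b m t < 1`). [folklore] -/
theorem hasDerivWithinAt_flowSel {x : Fin n → ℝ} {m t : ℝ} (hm : 0 ≤ m)
    (hx : ∀ c, |x c| ≤ m * w c) (ht : 0 ≤ t) (hq : b * m * t < 1) {s : ℝ} (hs : s ∈ Set.Icc 0 t) :
    HasDerivWithinAt (flowSel Q x) (Q (flowSel Q x s) (flowSel Q x s)) (Set.Icc 0 t) s := by
  have hsol := h.isSolOn_pseries hm hx ht hq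
  rw [h.flowSel_eq hsol hs]
  exact (hsol.2 s hs).congr (fun r hr => h.flowSel_eq hsol hr) (h.flowSel_eq hsol hs)

/-! ### Differentiability of the time-`s` map in the initial condition -/

/-- **The time-`s` map of the Taylor-series flow is Fréchet differentiable**, with derivative the
variational series: for `|y| ≤ M·w`, `0 ≤ s`, `b M s < 1` there is a continuous linear `L` with
`L z = Σ_k U y z k s^k` and `HasFDerivAt (y' ↦ Σ_k T y' k s^k) L y` — from the second-order majorant
`|Φ(y+h) - Φ(y) - L h| ≤ (g(M+η) - g(M) - η g'(M))·w = O(η²)`, `η = ‖h‖ Σ w⁻¹`, `g(z) = z/(1 - b z s)`.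
[folklore] -/
theorem hasFDerivAt_pseries_T {y : Fin n → ℝ} {M s : ℝ} (hy : ∀ c, |y c| ≤ M * w c) (hs : 0 ≤ s)
    (hq : b * M * s < 1) :
    ∃ L : (Fin n → ℝ) →L[ℝ] (Fin n → ℝ), (∀ z, L z = pseries (U y z) s) ∧
      HasFDerivAt (fun y' => pseries (T y') s) L y := by
  have hb := h.b_nonneg
  have hw := h.w_pos
  obtain ⟨Wm, hWm⟩ : ∃ Wm : ℝ, Wm = ∑ c, (w c)⁻¹ := ⟨_, rfl⟩
  obtain ⟨Wp, hWp⟩ : ∃ Wp : ℝ, Wp = ∑ c, w c := ⟨_, rfl⟩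
  have hWm0 : 0 ≤ Wm := hWm ▸ Finset.sum_nonneg fun c _ => (inv_pos.2 (hw c)).le
  have hWp0 : 0 ≤ Wp := hWp ▸ Finset.sum_nonneg fun c _ => (hw c).le
  have hzb : ∀ (z : Fin n → ℝ) (c : Fin n), |z c| ≤ ‖z‖ * Wm * w c := fun z c =>
    hWm ▸ abs_apply_le_norm_mul hw z c
  have hnb : ∀ (u : Fin n → ℝ) (N : ℝ), 0 ≤ N → (∀ c, |u c| ≤ N * w c) → ‖u‖ ≤ N * Wp :=
    fun u N hN hu => hWp ▸ norm_le_of_wbound hw hN hu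
  -- the candidate derivative, a linear map (finite dimension ⇒ continuous)
  let Llin : (Fin n → ℝ) →ₗ[ℝ] (Fin n → ℝ) :=
    { toFun := fun z => pseries (U y z) s
      map_add' := fun z z' => by
        funext c
        simp only [pseries, Pi.add_apply]
        rw [← (h.summable_U hy (hzb z) hs hq c).tsum_add (h.summable_U hy (hzb z') hs hq c)]
        refine tsum_congr fun k => ?_
        rw [h.U_add, Pi.add_apply, add_mul]
      map_smul' := fun r z => by
        funext c
        simp only [pseries, Pi.smul_apply, smul_eq_mul, RingHom.id_apply]
        rw [← tsum_mul_left]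
        refine tsum_congr fun k => ?_
        rw [h.U_smul, Pi.smul_apply, smul_eq_mul, mul_assoc] }
  refine ⟨LinearMap.toContinuousLinearMap Llin, fun z => rfl, ?_⟩
  -- the little-o estimate
  have hD : 0 < 1 - b * M * s := by linarith
  have hD0 : 1 - b * M * s ≠ 0 := hD.ne'
  have hbs : 0 ≤ b * s := mul_nonneg hb hs
  obtain ⟨C, hC⟩ : ∃ C : ℝ, C = 2 * b * s * Wp * Wm ^ 2 / (1 - b * M * s) ^ 3 := ⟨_, rfl⟩
  have hC0 : 0 ≤ C := by rw [hC]; positivity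
  rw [hasFDerivAt_iff_isLittleO_nhds_zero, Asymptotics.isLittleO_iff]
  intro ε hε
  have ev1 : ∀ᶠ hh : Fin n → ℝ in 𝓝 0, b * s * (‖hh‖ * Wm) ≤ (1 - b * M * s) / 2 := by
    have : Tendsto (fun hh : Fin n → ℝ => b * s * (‖hh‖ * Wm)) (𝓝 0) (𝓝 0) := by
      simpa using ((tendsto_norm_zero (E := Fin n → ℝ)).mul_const Wm).const_mul (b * s)
    exact this.eventually (Iic_mem_nhds (by linarith))
  have ev2 : ∀ᶠ hh : Fin n → ℝ in 𝓝 0, C * ‖hh‖ ≤ ε := by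
    have : Tendsto (fun hh : Fin n → ℝ => C * ‖hh‖) (𝓝 0) (𝓝 0) := by
      simpa using (tendsto_norm_zero (E := Fin n → ℝ)).const_mul C
    exact this.eventually (Iic_mem_nhds hε)
  filter_upwards [ev1, ev2] with hh h1 h2
  replace h1 : b * s * (‖hh‖ * Wm) ≤ (1 - b * M * s) / 2 := h1
  replace h2 : C * ‖hh‖ ≤ ε := h2
  obtain ⟨η, hη⟩ : ∃ η : ℝ, η = ‖hh‖ * Wm := ⟨_, rfl⟩
  have hη0 : 0 ≤ η := hη ▸ mul_nonneg (norm_nonneg _) hWm0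
  have hhb : ∀ c, |hh c| ≤ η * w c := fun c => hη ▸ hzb hh c
  rw [← hη] at h1
  have hmargin : (1 - b * M * s) / 2 ≤ 1 - b * (M + η) * s := by
    have e : 1 - b * (M + η) * s = (1 - b * M * s) - b * s * η := by ring
    rw [e]
    linarith
  have hD'pos : 0 < 1 - b * (M + η) * s := by linarith
  have hD'0 : 1 - b * (M + η) * s ≠ 0 := hD'pos.ne'
  have hq' : b * (M + η) * s < 1 := by linarith
  -- componentwise second-order bound and its closed form
  have hR : (M + η) / (1 - b * (M + η) * s) - M / (1 - b * M * s) - η / (1 - b * M * s) ^ 2 =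
      b * s * η ^ 2 / ((1 - b * (M + η) * s) * (1 - b * M * s) ^ 2) := by
    rw [div_sub_div _ _ hD'0 hD0, div_sub_div _ _ (mul_ne_zero hD'0 hD0) (pow_ne_zero 2 hD0),
      div_eq_div_iff (mul_ne_zero (mul_ne_zero hD'0 hD0) (pow_ne_zero 2 hD0))
        (mul_ne_zero hD'0 (pow_ne_zero 2 hD0))]
    ring
  have hRnn : 0 ≤ b * s * η ^ 2 / ((1 - b * (M + η) * s) * (1 - b * M * s) ^ 2) := by positivity
  have hRle : b * s * η ^ 2 / ((1 - b * (M + η) * s) * (1 - b * M * s) ^ 2) ≤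
      2 * b * s * η ^ 2 / (1 - b * M * s) ^ 3 := by
    rw [show 2 * b * s * η ^ 2 / (1 - b * M * s) ^ 3 =
      b * s * η ^ 2 / ((1 - b * M * s) / 2 * (1 - b * M * s) ^ 2) by field_simp]
    exact div_le_div_of_nonneg_left (by positivity) (by positivity)
      (mul_le_mul_of_nonneg_right hmargin (sq_nonneg _))
  have hcomp : ∀ c, |(pseries (T (y + hh)) s - pseries (T y) s - pseries (U y hh) s) c| ≤
      b * s * η ^ 2 / ((1 - b * (M + η) * s) * (1 - b * M * s) ^ 2) * w c := by
    intro c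
    rw [← hR]
    simpa only [Pi.sub_apply] using h.abs_pseries_taylor2_le hy hhb hs hq' c
  have hnorm : ‖pseries (T (y + hh)) s - pseries (T y) s - pseries (U y hh) s‖ ≤
      2 * b * s * η ^ 2 / (1 - b * M * s) ^ 3 * Wp :=
    (hnb _ _ hRnn hcomp).trans (mul_le_mul_of_nonneg_right hRle hWp0)
  calc ‖pseries (T (y + hh)) s - pseries (T y) s - (LinearMap.toContinuousLinearMap Llin) hh‖
      = ‖pseries (T (y + hh)) s - pseries (T y) s - pseries (U y hh) s‖ := rfl
    _ ≤ 2 * b * s * η ^ 2 / (1 - b * M * s) ^ 3 * Wp := hnorm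
    _ = C * ‖hh‖ * ‖hh‖ := by
        rw [hC, hη]
        field_simp
    _ ≤ ε * ‖hh‖ := mul_le_mul_of_nonneg_right h2 (norm_nonneg _)

/-- **Near a point of the convergence region the selector IS the Taylor series** (at the fixed time
`s`): for `|y| ≤ M·w`, `0 ≤ s`, `b M s < 1`, eventually in `y' → y`,
`flowSel Q y' s = Σ_k T y' k s^k`. [folklore] -/
theorem flowSel_eventuallyEq_pseries {y : Fin n → ℝ} {M s : ℝ} (hy : ∀ c, |y c| ≤ M * w c)
    (hs : 0 ≤ s) (hq : b * M * s < 1) :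
    (fun y' => flowSel Q y' s) =ᶠ[𝓝 y] (fun y' => pseries (T y') s) := by
  rcases isEmpty_or_nonempty (Fin n) with hn | ⟨⟨c₀⟩⟩
  · exact Filter.Eventually.of_forall fun y' => Subsingleton.elim _ _
  have hM : 0 ≤ M := h.nonneg_of_wbound c₀ (hy c₀)
  have hb := h.b_nonneg
  have hw := h.w_pos
  obtain ⟨Wm, hWm⟩ : ∃ Wm : ℝ, Wm = ∑ c, (w c)⁻¹ := ⟨_, rfl⟩
  have hWm0 : 0 ≤ Wm := hWm ▸ Finset.sum_nonneg fun c _ => (inv_pos.2 (hw c)).le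
  have hzb : ∀ (z : Fin n → ℝ) (c : Fin n), |z c| ≤ ‖z‖ * Wm * w c := fun z c =>
    hWm ▸ abs_apply_le_norm_mul hw z c
  have hD : 0 < 1 - b * M * s := by linarith
  have hbs : 0 ≤ b * s := mul_nonneg hb hs
  have ev : ∀ᶠ y' : Fin n → ℝ in 𝓝 y, b * s * (‖y' - y‖ * Wm) ≤ (1 - b * M * s) / 2 := by
    have : Tendsto (fun y' : Fin n → ℝ => b * s * (‖y' - y‖ * Wm)) (𝓝 y) (𝓝 0) := by
      simpa using ((tendsto_norm_sub_self y).mul_const Wm).const_mul (b * s)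
    exact this.eventually (Iic_mem_nhds (by linarith))
  filter_upwards [ev] with y' h1
  replace h1 : b * s * (‖y' - y‖ * Wm) ≤ (1 - b * M * s) / 2 := h1
  obtain ⟨η, hη⟩ : ∃ η : ℝ, η = ‖y' - y‖ * Wm := ⟨_, rfl⟩
  have hη0 : 0 ≤ η := hη ▸ mul_nonneg (norm_nonneg _) hWm0
  rw [← hη] at h1
  have hy' : ∀ c, |y' c| ≤ (M + η) * w c := by
    have := wbound_add hy (fun c => hη ▸ hzb (y' - y) c)
    simpa only [add_sub_cancel] using this
  have hq' : b * (M + η) * s < 1 := by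
    have e : b * (M + η) * s = b * M * s + b * s * η := by ring
    rw [e]
    linarith
  exact h.flowSel_eq_pseries (add_nonneg hM hη0) hy' hs hq' ⟨hs, le_rfl⟩

/-- **`HasFDerivAt` of the selector's time-`s` map** at `y` (`|y| ≤ M·w`, `0 ≤ s`, `b M s < 1`), with
derivative `L z = Σ_k U y z k s^k`. [folklore] -/
theorem hasFDerivAt_flowSel {y : Fin n → ℝ} {M s : ℝ} (hy : ∀ c, |y c| ≤ M * w c) (hs : 0 ≤ s)
    (hq : b * M * s < 1) :
    ∃ L : (Fin n → ℝ) →L[ℝ] (Fin n → ℝ), (∀ z, L z = pseries (U y z) s) ∧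
      HasFDerivAt (fun y' => flowSel Q y' s) L y := by
  obtain ⟨L, hL, hF⟩ := h.hasFDerivAt_pseries_T hy hs hq
  exact ⟨L, hL, hF.congr_of_eventuallyEq (h.flowSel_eventuallyEq_pseries hy hs hq)⟩

end IsMajorantSystem

end Summit.NavierStokesRegularity.NavierStokesRegularity.Theorems.TaylorModelMajorant

namespace Summit.NavierStokesRegularity.NavierStokesRegularity.Theorems.TaylorModel

open Set Summit.NavierStokesRegularity.NavierStokesRegularity.Theorems.TaylorModelMajorant

/-- **S1 · analytic soundness of Taylor models for quadratic fields (method of majorants).**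
For a field `Q` on `Fin n → ℝ`, linear in each argument with the weighted bilinear bound
`|Q u v|_c ≤ b·Nu·Nv·w_c`, and Taylor / variational jets `T`, `U` given by the Cauchy-product recursions,
the global flow selector `Φ := flowSel Q` satisfies: `Φ x 0 = x`; every solution on `[0,t]` from `x` IS
`Φ x` there (Grönwall uniqueness); and for `|x| ≤ m·w`, `b m t < 1`: `Φ x` solves on `[0,t]` (it is the
sum of the majorised Taylor series), the Cauchy estimates `|T x k| ≤ m(bm)^k w`, the enclosure
`|Φ x s| ≤ m/(1-bms)·w`, the sharp Taylor remainder, and — for `|v| ≤ ρ·w`, `b(m+ρ)t < 1` — the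
variational coefficient bound, the first-variation (Lipschitz) bound, the second-order remainder bound,
and `HasFDerivAt` of `y ↦ Φ y s` at `x+v` with derivative `z ↦ Σ_k U (x+v) z k s^k` and its two operator
bounds. Closes the registered stub `stub_soundness` of line `taylor-model` (skeleton v3
`9391589be9c875b2`) on stmt-NavierStokesRegularity-23954 BY NAME; MODEL rung TL-M3 only — nothing here
is a statement about the Navier–Stokes equations. [folklore] -/
theorem stub_soundness : Summit.NavierStokesRegularity.NavierStokesRegularity.Theorems.TaylorModel.TaylorModelSoundness := by
  intro n Q w b T U hw hb hlinr hlinl hbound hT0 hTsucc hU0 hUsucc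
  have h : IsMajorantSystem n Q w b T U := ⟨hw, hb, hlinr, hlinl, hbound, hT0, hTsucc, hU0, hUsucc⟩
  refine ⟨flowSel Q, fun x => flowSel_zero x,
    fun x t ψ _ht hψ0 hψ s hs => (h.flowSel_eq ⟨hψ0, hψ⟩ hs).symm, ?_⟩
  intro x m t hm hx ht hq
  have hbm : 0 ≤ b * m := mul_nonneg hb hm
  have hqs : ∀ s ∈ Icc (0 : ℝ) t, b * m * s < 1 := fun s hs =>
    lt_of_le_of_lt (mul_le_mul_of_nonneg_left hs.2 hbm) hq
  have E : ∀ s ∈ Icc (0 : ℝ) t, flowSel Q x s = pseries (T x) s := fun s hs =>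
    h.flowSel_eq_pseries hm hx ht hq hs
  refine ⟨fun s hs => h.hasDerivWithinAt_flowSel hm hx ht hq hs, h.T_bound hx, fun s hs c => ?_,
    fun s hs p c => ?_, ?_⟩
  · rw [E s hs]
    exact h.abs_pseries_T_le hx hs.1 (hqs s hs) c
  · rw [E s hs]
    exact h.abs_pseries_T_sub_sum_le hx hs.1 (hqs s hs) p c
  intro v ρ hρ hv hq'
  have hbm' : 0 ≤ b * (m + ρ) := mul_nonneg hb (add_nonneg hm hρ)
  have hqs' : ∀ s ∈ Icc (0 : ℝ) t, b * (m + ρ) * s < 1 := fun s hs =>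
    lt_of_le_of_lt (mul_le_mul_of_nonneg_left hs.2 hbm') hq'
  have hxv : ∀ c, |(x + v) c| ≤ (m + ρ) * w c := wbound_add hx hv
  have E' : ∀ s ∈ Icc (0 : ℝ) t, flowSel Q (x + v) s = pseries (T (x + v)) s := fun s hs =>
    h.flowSel_eq_pseries (add_nonneg hm hρ) hxv ht hq' hs
  refine ⟨h.U_bound hx hv, fun s hs c => ?_, fun s hs p c => ?_, fun s hs => ?_⟩
  · rw [E' s hs, E s hs]
    exact h.abs_pseries_T_sub_le hx hv hs.1 (hqs' s hs) c
  · rw [E' s hs, E s hs]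
    have e : pseries (T (x + v)) s c - pseries (T x) s c -
        ∑ k ∈ Finset.range (p + 1), U x v k c * s ^ k =
        (pseries (T (x + v)) s c - pseries (T x) s c - pseries (U x v) s c) +
          (pseries (U x v) s c - ∑ k ∈ Finset.range (p + 1), U x v k c * s ^ k) := by ring
    rw [e]
    refine (abs_add_le _ _).trans ((add_le_add (h.abs_pseries_taylor2_le hx hv hs.1 (hqs' s hs) c)
      (h.abs_pseries_U_sub_sum_le hx hv hs.1 (hqs s hs) p c)).trans_eq ?_)
    ring
  · obtain ⟨L, hL, hF⟩ := h.hasFDerivAt_flowSel hxv hs.1 (hqs' s hs)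
    refine ⟨L, hF, fun z ζ _hζ hz c => ?_, fun z ζ p _hζ hz c => ?_⟩
    · rw [hL]
      exact h.abs_pseries_U_le hxv hz hs.1 (hqs' s hs) c
    · rw [hL]
      have e : pseries (U (x + v) z) s c - ∑ k ∈ Finset.range (p + 1), U x z k c * s ^ k =
          (pseries (U (x + v) z) s c - pseries (U x z) s c) +
            (pseries (U x z) s c - ∑ k ∈ Finset.range (p + 1), U x z k c * s ^ k) := by ring
      rw [e]
      refine (abs_add_le _ _).trans ((add_le_add (h.abs_pseries_U_sub_le hx hv hz hs.1 (hqs' s hs) c)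
        (h.abs_pseries_U_sub_sum_le hx hz hs.1 (hqs s hs) p c)).trans_eq ?_)
      ring

end Summit.NavierStokesRegularity.NavierStokesRegularity.Theorems.TaylorModel

end
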